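import Literature.AlgebraicGeometry.Frobenioids.ArchimedeanSlitMorphisms
import HarnessLib

/-!
# Frobenioids II, Example 3.3 (iv) with the author's Comments (Feb 2019), item (4): arrows between real objects of `N₀`

Mochizuki, *The geometry of Frobenioids II: poly-Frobenioids*, Kyushu J. Math. **62** (2008)
401–460, §3, Example 3.3 (iv), author's text p. 29: "all real objects of `N₀` are isomorphic"
(PROVED as `ArchFrd.N0.nonempty_iso_of_isRealObj`, `AngularFrobenioids.lean`); the author's
*Comments* (Feb 2019), item (4), strengthen this (optionally) to "all MORPHISMS between real objects of
`N₀` are isomorphisms". This file proves the strengthened form: an arrow of `N₀` between real objects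
is a linear isometry over `id_{Spec ℝ}` out of an isotropic object, hence invertible in `C₀`
(`C0.isIso_of_isIsotropic`) and in `N₀`. [cite: MochizukiFrdII2008, Ex 3.3 (iv) p.29]
-/

namespace Literature.AlgebraicGeometry.Frobenioids

open CategoryTheory

noncomputable section

namespace ArchFrd

/-- **Example 3.3 (iv), author's Comments (Feb 2019) (4)**: every morphism between real objects of
`N₀` is an isomorphism. [cite: MochizukiFrdII2008, Ex 3.3 (iv) p.29] -/
theorem N0.isIso_of_isRealObj {X Y : N0} (f : X ⟶ Y) (hX : X.carrier.IsRealObj)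
    (hY : Y.carrier.IsRealObj) : IsIso f := by
  have hlin : C0.degFr (N0.homCarrier f) = 1 := f.2
  have hiso := (A0.isIsometry_iff_norm_mul_tip_pow (N0.homCarrier f)).mp f.1.2
  -- the base arrow `Spec ℝ → Spec ℝ` is the identity
  haveI : IsIso (C0.Base (N0.homCarrier f)) := by
    have hb : C0.Base (N0.homCarrier f) = eqToHom (by rw [show X.carrier.base = D0.real from hX,
        show Y.carrier.base = D0.real from hY]) := Subsingleton.elim
      (α := X.carrier.base ⟶ Y.carrier.base) (h := by
        rw [show X.carrier.base = D0.real from hX, show Y.carrier.base = D0.real from hY]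
        exact D0.subsingleton_hom_real_real) _ _
    rw [hb]; infer_instance
  haveI : IsIso (N0.homCarrier f) :=
    C0.isIso_of_isIsotropic _ (C0.isNaivelyIsotropic_of_isRealObj hX) hlin hiso
  exact N0.isIso_of_isIso_carrier f

end ArchFrd

end

end Literature.AlgebraicGeometry.Frobenioids
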